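import Mathlib.Algebra.CharP.Two
import Literature.NumberTheory.GaloisRepresentations.ProjectiveTypeSolvable
import Literature.NumberTheory.GaloisRepresentations.SerreProp16PGL2
import HarnessLib

/-!
# Solvable irreducible subgroups of `GL₂` in characteristic `2` are of dihedral type
# (Khare–Wintenberger (I), Lemma 6.1)

Topic `Literature/NumberTheory/GaloisRepresentations`; theorems only (no definitions, no named
facts).  Companion of `ProjectiveTypeSolvable` (the characteristic-`0` solvable case of Klein's
classification: dihedral, tetrahedral or octahedral) and an input of the proof of Serre's
modularity conjecture (`Literature.NumberTheory.Automorphic.khare_wintenberger`):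

> **Lemma 6.1** (Khare–Wintenberger, *Serre's modularity conjecture (I)*, Invent. Math. 178
> (2009), §6).  Let `G` be a finite, solvable subgroup of `GL₂(𝔽̄₂)` which acts irreducibly on
> `𝔽̄₂²`.  Then the projective image of `G` is dihedral.

Khare–Wintenberger deduce it from Dickson's theorem ("the projective image of `G` is isomorphic
to a dihedral group, `A₄` or `S₄`"), ruling out `S₄` because an element of `GL₂(𝔽̄₂)` of
`2`-power order has order `1` or `2`, and `A₄` because its normal subgroup of order `4` would be
unipotent, hence upper triangular, contradicting irreducibility.  Dickson's theorem over `𝔽̄₂`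
(subgroups of order divisible by the characteristic) is not in the tree, so the proof below
follows instead the architecture of `ProjectiveTypeSolvable.projectiveType_of_not_hasCommonEigenvector`
(last non-trivial term `M` of the derived series of the projective image), the two
characteristic-`2` phenomena of Khare–Wintenberger's argument entering as follows.

* **Involutions are unipotent** (`CharTwoPGL2.exists_eq_smul_one_add`): if `\bar x ∈ PGL₂(k)`
  (`char k = 2`, `k` algebraically closed) is a non-trivial involution then `x = c (1 + n)` with
  `n ≠ 0`, `n² = 0` (from `x² = e·1` and `(c⁻¹x + 1)² = c⁻²x² + 1 = 0` as `2 = 0`), so `x` has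
  a unique eigenline `ker n`; projectively commuting involutions genuinely commute (the scalar
  `u` with `u (xy) = yx` has `u² = 1`, so `u = 1`) and then share their eigenline
  (`CharTwoPGL2.mulVec_eq_zero_of_commute`).  Hence a non-empty conjugation-stable family of
  pairwise projectively commuting involutions of `ρ(G)` has a common eigenvector
  (`CharTwoPGL2.hasCommonEigenvector_of_involutions`) — this replaces "`A₄` is impossible".
  Applied to the involutions of the abelian normal subgroup `M`: irreducibility forces `M` to
  have **no** involution, so every element of `M` has odd order.
* **Odd order is prime to the characteristic**: a non-trivial `\bar y ∈ M` then diagonalises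
  with distinct eigenvalues (`CharTwoPGL2.exists_conj_eq_diagonal_of_mk_pow_eq_one`, from the
  tree's characteristic-free `Serre1972.exists_conj_eq_diagonal_of_natCast_ne_zero`); the
  elements of `M` (commuting with `\bar y`) have diagonal or antidiagonal lifts, antidiagonal ones
  being involutions, so all are diagonal; normality of `M` then makes every `ρ(g)` diagonal or
  antidiagonal (`GL2.isDg_or_isAd_of_mul_diagonal`), i.e. `ρ` is monomial, and
  `isDihedralType_of_monomial` gives the dihedral projective image `D_m`, `m ≥ 2` — this
  replaces "`S₄` is impossible" (indeed `m` is odd here, though we do not record it).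

## Main results (all proved)

* `isDihedralType_of_not_hasCommonEigenvector_of_charTwo` — `G` finite, `k` algebraically
  closed of characteristic `2`, `ρ : G →* GL₂(k)` without common eigenvector and with solvable
  projective image ⇒ `IsDihedralType ρ`.
* `isDihedralType_of_isIrreducible_of_isSolvable_of_charTwo` — **Khare–Wintenberger's
  Lemma 6.1** in the language of `ProjectiveType`: `ρ : G →* GL₂(k)` with finite solvable image
  and irreducible standard representation, `k` algebraically closed of characteristic `2` ⇒ the
  projective image is dihedral (`IsDihedralType ρ`: `≃* DihedralGroup m`, `m ≥ 2`);
  `isDihedralType_subtype_of_isSolvable_of_charTwo` — the same for a finite solvable subgroup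
  `H ≤ GL₂(k)` acting irreducibly, literally as printed.

## References

* C. Khare, J.-P. Wintenberger, *Serre's modularity conjecture (I)*, Invent. Math. 178 (2009),
  485–504, §6, Lemma 6.1 (with the remark "We thank Serre for some correspondence about
  this"). [KhareWintenberger2009]
* L. E. Dickson, *Linear groups* (1901), §260; B. Huppert, *Endliche Gruppen I*, II.8.27
  (Dickson's theorem, cited as [10] by Khare–Wintenberger; not used here).
-/

open Matrix Subgroup
open scoped MatrixGroups

namespace Literature.NumberTheory.GaloisRepresentations

/-! ### Part 1: involutions of `PGL₂(k)` in characteristic `2` -/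

namespace CharTwoPGL2

variable {k : Type*} [Field k]

/-- In characteristic `2`, `v + v = 0` in every `k`-module. [folklore] -/
theorem add_self_eq_zero_of_charTwo (K : Type*) [Ring K] [CharP K 2] {V : Type*} [AddCommGroup V]
    [Module K V] (v : V) : v + v = 0 := by
  rw [← two_smul K v, CharTwo.two_eq_zero, zero_smul]

open Matrix.ProjGenLinGroup in
/-- **Involutions of `PGL₂(k)` are unipotent in characteristic `2`.**  If the class of
`x ∈ GL₂(k)` (`k` algebraically closed, `char k = 2`) is a non-trivial involution, then
`x = c (1 + n)` with `c ≠ 0`, `n ≠ 0`, `n² = 0`: indeed `x² = e · 1`, `e = c²`, and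
`(c⁻¹ x + 1)² = c⁻² x² + 2 c⁻¹ x + 1 = 1 + 1 = 0`.  (Khare–Wintenberger: "any element in
`GL₂(𝔽̄₂)` of order a power of `2` is forced to be of order `1` or `2`", "a Sylow `2`-subgroup
… is given by the unipotent matrices".) [cite: KhareWintenberger2009, §6, proof of Lemma 6.1] -/
theorem exists_eq_smul_one_add [CharP k 2] [IsAlgClosed k] {x : GL (Fin 2) k}
    (hx1 : mk x ≠ 1) (hx2 : mk x * mk x = 1) :
    ∃ (c : k) (n : Matrix (Fin 2) (Fin 2) k),
      c ≠ 0 ∧ n ≠ 0 ∧ n * n = 0 ∧ (x : Matrix (Fin 2) (Fin 2) k) = c • (1 + n) := by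
  rw [← map_mul, Matrix.ProjGenLinGroup.mk_eq_one, GL2.mem_center_iff,
    Matrix.GeneralLinearGroup.coe_mul] at hx2
  obtain ⟨h01, h10, h00⟩ := hx2
  have hxx : (x : Matrix (Fin 2) (Fin 2) k) * x =
      (((x : Matrix (Fin 2) (Fin 2) k) * x) 1 1) • (1 : Matrix (Fin 2) (Fin 2) k) := by
    ext i j
    fin_cases i <;> fin_cases j <;> simp [h01, h10, h00]
  set e : k := ((x : Matrix (Fin 2) (Fin 2) k) * x) 1 1 with he
  have he0 : e ≠ 0 := by
    intro h0
    apply GL2.det_ne_zero (x * x)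
    rw [Matrix.GeneralLinearGroup.coe_mul, hxx, h0, zero_smul, det_zero]
  obtain ⟨c, hc⟩ := IsAlgClosed.exists_eq_mul_self e
  have hc0 : c ≠ 0 := by
    rintro rfl
    exact he0 (by rw [hc, mul_zero])
  have h11 : (1 : Matrix (Fin 2) (Fin 2) k) + 1 = 0 :=
    add_self_eq_zero_of_charTwo k (1 : Matrix (Fin 2) (Fin 2) k)
  refine ⟨c, c⁻¹ • (x : Matrix (Fin 2) (Fin 2) k) + 1, hc0, ?_, ?_, ?_⟩
  · -- `n ≠ 0`, as `x` is not scalar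
    intro hn
    apply hx1
    have hX : (x : Matrix (Fin 2) (Fin 2) k) = c • (1 : Matrix (Fin 2) (Fin 2) k) := by
      have h1 : c⁻¹ • (x : Matrix (Fin 2) (Fin 2) k) = 1 := by
        have := neg_eq_of_add_eq_zero_left hn
        rw [← this, neg_eq_iff_add_eq_zero, h11]
      calc (x : Matrix (Fin 2) (Fin 2) k) = c • (c⁻¹ • (x : Matrix (Fin 2) (Fin 2) k)) := by
            rw [smul_smul, mul_inv_cancel₀ hc0, one_smul]
        _ = c • (1 : Matrix (Fin 2) (Fin 2) k) := by rw [h1]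
    rw [Matrix.ProjGenLinGroup.mk_eq_one, GL2.mem_center_iff]
    simp [hX]
  · -- `n² = 0`
    calc (c⁻¹ • (x : Matrix (Fin 2) (Fin 2) k) + 1) * (c⁻¹ • (x : Matrix (Fin 2) (Fin 2) k) + 1)
        = (c⁻¹ * c⁻¹) • ((x : Matrix (Fin 2) (Fin 2) k) * x) +
            (c⁻¹ • (x : Matrix (Fin 2) (Fin 2) k) + c⁻¹ • (x : Matrix (Fin 2) (Fin 2) k)) + 1 := by
          rw [add_mul, mul_add, mul_add, mul_one, one_mul, one_mul, smul_mul_assoc,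
            mul_smul_comm, smul_smul]
          abel
      _ = 0 := by
          rw [hxx, smul_smul, hc, show c⁻¹ * c⁻¹ * (c * c) = 1 by field_simp, one_smul,
            add_self_eq_zero_of_charTwo k, add_zero, h11]
  · -- `x = c (1 + n)`
    symm
    rw [smul_add, smul_add, smul_smul, mul_inv_cancel₀ hc0, one_smul, add_left_comm,
      add_self_eq_zero_of_charTwo k, add_zero]

/-- For `X = c (1 + n)` with `c ≠ 0`, `n² = 0`: every eigenvector of `X` is killed by `n`
(`c n w = (a - c) w`, apply `n`). [folklore] -/
theorem mulVec_eq_zero_of_mulVec_eq_smul {X n : Matrix (Fin 2) (Fin 2) k} {c : k} (hc : c ≠ 0)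
    (hX : X = c • (1 + n)) (hn : n * n = 0) {w : Fin 2 → k} {a : k} (hw : X *ᵥ w = a • w) :
    n *ᵥ w = 0 := by
  have h1 : c • (n *ᵥ w) = (a - c) • w := by
    rw [hX, Matrix.smul_mulVec, Matrix.add_mulVec, Matrix.one_mulVec, smul_add] at hw
    rw [sub_smul]
    exact eq_sub_of_add_eq' hw
  have h2 : (a - c) • (n *ᵥ w) = 0 := by
    have := congrArg (fun z => n *ᵥ z) h1
    simp only [Matrix.mulVec_smul, Matrix.mulVec_mulVec, hn, Matrix.zero_mulVec,
      smul_zero] at this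
    exact this.symm
  rcases smul_eq_zero.mp h2 with h | h
  · rw [sub_eq_zero.mp h, sub_self, zero_smul] at h1
    exact (smul_eq_zero.mp h1).resolve_left hc
  · exact h

/-- For `X = c (1 + n)`: vectors killed by `n` are eigenvectors of `X`. [folklore] -/
theorem mulVec_eq_smul_of_mulVec_eq_zero {X n : Matrix (Fin 2) (Fin 2) k} {c : k}
    (hX : X = c • (1 + n))
    {w : Fin 2 → k} (hw : n *ᵥ w = 0) : X *ᵥ w = c • w := by
  rw [hX, Matrix.smul_mulVec, Matrix.add_mulVec, Matrix.one_mulVec, hw, add_zero]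

/-- Two commuting square-zero `2 × 2` matrices `n ≠ 0`, `n'` have `ker n ⊆ ker n'`: if
`n v = 0`, `v ≠ 0`, then `n' v ∈ ker n = k v`, `n' v = a v`, and `0 = n'² v = a² v`. [folklore] -/
theorem mulVec_eq_zero_of_commute {n n' : Matrix (Fin 2) (Fin 2) k} (hn : n ≠ 0)
    (hn' : n' * n' = 0)
    (hcomm : n * n' = n' * n) {v : Fin 2 → k} (hv : v ≠ 0) (hnv : n *ᵥ v = 0) :
    n' *ᵥ v = 0 := by
  have h1 : n *ᵥ (n' *ᵥ v) = 0 := by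
    rw [Matrix.mulVec_mulVec, hcomm, ← Matrix.mulVec_mulVec, hnv, Matrix.mulVec_zero]
  obtain ⟨a, ha⟩ := Serre1972.exists_eq_smul_of_mulVec_eq_zero hn hv hnv h1
  have h2 : (a * a) • v = 0 := by
    have : n' *ᵥ (n' *ᵥ v) = 0 := by rw [Matrix.mulVec_mulVec, hn', Matrix.zero_mulVec]
    rwa [ha, Matrix.mulVec_smul, ha, smul_smul] at this
  rcases smul_eq_zero.mp h2 with h | h
  · rw [ha, mul_self_eq_zero.mp h, zero_smul]
  · exact absurd h hv

/-- **Projectively commuting involutions commute** (`char k = 2`): if `x = c (1 + n)`,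
`y = c' (1 + n')` and `u (x y) = y x` for a unit `u`, then `u² = 1` forces `u = 1`, and
`(1 + n)(1 + n') = (1 + n')(1 + n)` gives `n n' = n' n`. [folklore] -/
theorem commute_of_smul_mul_eq [CharP k 2] {x y : GL (Fin 2) k} {c c' : k}
    {n n' : Matrix (Fin 2) (Fin 2) k} (hc : c ≠ 0) (hc' : c' ≠ 0)
    (hx : (x : Matrix (Fin 2) (Fin 2) k) = c • (1 + n))
    (hy : (y : Matrix (Fin 2) (Fin 2) k) = c' • (1 + n')) {u : kˣ}
    (h : (u : k) • ((x : Matrix (Fin 2) (Fin 2) k) * y) = (y : Matrix (Fin 2) (Fin 2) k) * x) :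
    n * n' = n' * n := by
  have hu : (u : k) = 1 := by
    rcases GL2.sq_eq_one_of_smul_mul_eq h with h1 | h1
    · exact h1
    · rw [h1, CharTwo.neg_eq]
  rw [hu, one_smul, hx, hy, smul_mul_smul_comm, smul_mul_smul_comm, mul_comm c' c] at h
  have h' : (1 + n) * (1 + n') = (1 + n') * (1 + n) :=
    smul_right_injective (Matrix (Fin 2) (Fin 2) k) (mul_ne_zero hc hc') h
  have e1 : (1 + n) * (1 + n') = (1 + n + n') + n * n' := by noncomm_ring
  have e2 : (1 + n') * (1 + n) = (1 + n + n') + n' * n := by noncomm_ring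
  rw [e1, e2] at h'
  exact add_left_cancel h'

open Matrix.ProjGenLinGroup in
/-- **A conjugation-stable family of pairwise commuting involutions has a common eigenvector**
(`char k = 2`, `k` algebraically closed).  Let `ρ : G →* GL₂(k)` and `S ⊆ G` be non-empty,
stable under `s ↦ g⁻¹ s g`, with every `\bar ρ(s)` (`s ∈ S`) a non-trivial involution and
`\bar ρ(s) \bar ρ(t) = \bar ρ(t) \bar ρ(s)` for `s, t ∈ S`.  Then `ρ(G)` has a common
eigenvector: the eigenline `ker n` of `ρ(s₀) = c(1 + n)` is that of every conjugate
`ρ(g)⁻¹ ρ(s₀) ρ(g) = c(1 + ρ(g)⁻¹ n ρ(g))` (they commute), so `ρ(g)` preserves it.  This is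
the characteristic-`2` substitute for "`A₄` is impossible" in Khare–Wintenberger's proof of
Lemma 6.1. [cite: KhareWintenberger2009, §6, proof of Lemma 6.1] -/
theorem hasCommonEigenvector_of_involutions [CharP k 2] [IsAlgClosed k] {G : Type*} [Group G]
    (ρ : G →* GL (Fin 2) k) (S : Set G) (hS : S.Nonempty)
    (hinv : ∀ s ∈ S, mk (ρ s) ≠ 1 ∧ mk (ρ s) * mk (ρ s) = 1)
    (hcomm : ∀ s ∈ S, ∀ t ∈ S, mk (ρ s) * mk (ρ t) = mk (ρ t) * mk (ρ s))
    (hconj : ∀ g : G, ∀ s ∈ S, g⁻¹ * s * g ∈ S) : HasCommonEigenvector ρ := by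
  obtain ⟨s₀, hs₀⟩ := hS
  obtain ⟨c, n, hc, hn0, hnn, hX⟩ :=
    exists_eq_smul_one_add (hinv s₀ hs₀).1 (hinv s₀ hs₀).2
  obtain ⟨v, hv, hnv⟩ := Serre1972.exists_ne_zero_mulVec_eq_zero hn0 hnn
  refine ⟨v, hv, fun g => ?_⟩
  set P : Matrix (Fin 2) (Fin 2) k := ((ρ g : GL (Fin 2) k) : Matrix (Fin 2) (Fin 2) k) with hP
  set Pi : Matrix (Fin 2) (Fin 2) k := (((ρ g)⁻¹ : GL (Fin 2) k) : Matrix (Fin 2) (Fin 2) k)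
    with hPi
  have hPiP : Pi * P = 1 := by
    rw [hPi, hP, ← Matrix.GeneralLinearGroup.coe_mul, inv_mul_cancel,
      Matrix.GeneralLinearGroup.coe_one]
  have hPPi : P * Pi = 1 := by
    rw [hPi, hP, ← Matrix.GeneralLinearGroup.coe_mul, mul_inv_cancel,
      Matrix.GeneralLinearGroup.coe_one]
  -- the conjugate involution `t = g⁻¹ s₀ g ∈ S`
  have ht : ((ρ (g⁻¹ * s₀ * g) : GL (Fin 2) k) : Matrix (Fin 2) (Fin 2) k) =
      c • (1 + Pi * n * P) := by
    rw [map_mul, map_mul, map_inv, Matrix.GeneralLinearGroup.coe_mul,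
      Matrix.GeneralLinearGroup.coe_mul, ← hPi, ← hP, hX, mul_smul_comm, smul_mul_assoc,
      mul_add, mul_one, add_mul, hPiP]
  have hnt : (Pi * n * P) * (Pi * n * P) = 0 := by
    rw [show Pi * n * P * (Pi * n * P) = Pi * (n * ((P * Pi) * n)) * P by noncomm_ring, hPPi,
      one_mul, hnn, mul_zero, zero_mul]
  have hcomm' := hcomm s₀ hs₀ _ (hconj g s₀ hs₀)
  rw [← map_mul Matrix.ProjGenLinGroup.mk, ← map_mul Matrix.ProjGenLinGroup.mk,
    GL2.mk_eq_mk_iff_smul, Matrix.GeneralLinearGroup.coe_mul,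
    Matrix.GeneralLinearGroup.coe_mul] at hcomm'
  obtain ⟨u, hu⟩ := hcomm'
  have hnc : n * (Pi * n * P) = (Pi * n * P) * n := commute_of_smul_mul_eq hc hc hX ht hu
  have h1 : (Pi * n * P) *ᵥ v = 0 := mulVec_eq_zero_of_commute hn0 hnt hnc hv hnv
  have h2 : n *ᵥ (P *ᵥ v) = 0 := by
    have := congrArg (fun z => P *ᵥ z) h1
    simpa only [Matrix.mulVec_mulVec, Matrix.mulVec_zero, ← mul_assoc, hPPi, one_mul] using this
  obtain ⟨a, ha⟩ := Serre1972.exists_eq_smul_of_mulVec_eq_zero hn0 hv hnv h2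
  exact ⟨a, ha⟩

/-! ### Part 2: odd order, diagonalisation -/

open Matrix.ProjGenLinGroup in
/-- **Diagonalisation of elements of finite projective order prime to the characteristic**
(`k` algebraically closed, any characteristic): if `\bar y ^ t = 1` in `PGL₂(k)` with
`(t : k) ≠ 0` and `y` is not scalar, then `Q⁻¹ y Q = diag(d₀, d₁)` with `d₀ ≠ d₁`.  (`y^t` is a
scalar `e`; with `f^t = e`, `a = f⁻¹ y` has `a^t = 1` and the tree's
`Serre1972.exists_conj_eq_diagonal_of_natCast_ne_zero` applies.) [folklore] -/
theorem exists_conj_eq_diagonal_of_mk_pow_eq_one [IsAlgClosed k] (y : GL (Fin 2) k) {t : ℕ}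
    (ht : (t : k) ≠ 0) (hyt : mk y ^ t = 1) (hy : y ∉ center (GL (Fin 2) k)) :
    ∃ (Q : GL (Fin 2) k) (d : Fin 2 → k), d 0 ≠ d 1 ∧
      ((Q⁻¹ * y * Q : GL (Fin 2) k) : Matrix (Fin 2) (Fin 2) k) = diagonal d := by
  have ht0 : t ≠ 0 := by
    rintro rfl
    exact ht Nat.cast_zero
  rw [← map_pow, Matrix.ProjGenLinGroup.mk_eq_one,
    Matrix.GeneralLinearGroup.center_eq_range_scalar] at hyt
  obtain ⟨e, he⟩ := hyt
  obtain ⟨f, hf⟩ := IsAlgClosed.exists_pow_nat_eq (e : k) (Nat.pos_of_ne_zero ht0)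
  have hf0 : f ≠ 0 := by
    rintro rfl
    rw [zero_pow ht0] at hf
    exact e.ne_zero hf.symm
  set s : GL (Fin 2) k := Matrix.GeneralLinearGroup.scalar (Fin 2) (Units.mk0 f hf0) with hs
  have hsc : s ∈ center (GL (Fin 2) k) := by
    rw [Matrix.GeneralLinearGroup.center_eq_range_scalar]
    exact ⟨_, rfl⟩
  have hst : s ^ t = y ^ t := by
    rw [hs, ← map_pow, ← he]
    congr 1
    ext
    rw [Units.val_pow_eq_pow_val, Units.val_mk0, hf]
  set a : GL (Fin 2) k := y * s⁻¹ with ha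
  have hcomm : Commute y s⁻¹ := by
    have := Subgroup.mem_center_iff.mp (inv_mem hsc) y
    exact this
  have hat : a ^ t = 1 := by
    rw [ha, hcomm.mul_pow, inv_pow, hst, mul_inv_cancel]
  have hya : y = a * s := by rw [ha, inv_mul_cancel_right]
  have hac : a ∉ center (GL (Fin 2) k) := by
    intro h
    apply hy
    rw [hya]
    exact mul_mem h hsc
  obtain ⟨Q, d, hd, hQ⟩ := Serre1972.exists_conj_eq_diagonal_of_natCast_ne_zero a ht hat hac
  refine ⟨Q, f • d, ?_, ?_⟩
  · simpa [hf0] using hd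
  · have hsQ : s * Q = Q * s := (Subgroup.mem_center_iff.mp hsc Q).symm
    have h1 : Q⁻¹ * y * Q = Q⁻¹ * a * Q * s := by
      rw [hya, ← mul_assoc, mul_assoc _ s Q, hsQ, ← mul_assoc]
    rw [h1, hs, GL2.coe_mul_scalar, Units.val_mk0, hQ, diagonal_smul]

end CharTwoPGL2

/-! ### Part 3: the solvable case in characteristic `2` -/

section Core

variable {G : Type*} [Group G] {k : Type*} [Field k]

open Matrix.ProjGenLinGroup in
/-- **Finite solvable projective image without common eigenvector is dihedral, in
characteristic `2`.**  `G` finite, `k` algebraically closed with `char k = 2`,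
`ρ : G →* GL₂(k)` with no common eigenvector and `\bar ρ(G)` solvable: then `ρ` is of dihedral
type.  Proof: the last non-trivial term `M` of the derived series of `\bar ρ(G)` is abelian and
normal; its involutions form a conjugation-stable commuting family, so there are none
(`CharTwoPGL2.hasCommonEigenvector_of_involutions`); hence `M` has odd exponent, a non-trivial
`\bar y ∈ M` diagonalises with distinct eigenvalues, the elements of `M` have diagonal lifts
(antidiagonal ones would be involutions), normality of `M` makes `ρ` monomial, and
`isDihedralType_of_monomial` concludes. [cite: KhareWintenberger2009, §6, Lemma 6.1] -/
theorem isDihedralType_of_not_hasCommonEigenvector_of_charTwo [Finite G] [IsAlgClosed k]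
    [CharP k 2] (ρ : G →* GL (Fin 2) k) (hce : ¬ HasCommonEigenvector ρ)
    (hs : IsSolvable (projectiveImage ρ)) : IsDihedralType ρ := by
  classical
  haveI := finite_range_of_finite ρ
  haveI : Finite (projectiveImage ρ) := finite_projectiveImage_of_finite_range ρ
  -- some `ρ g` is not scalar
  have hnt : ∃ g, mk (ρ g) ≠ 1 := by
    by_contra h
    push Not at h
    exact hce (hasCommonEigenvector_of_forall_isDg fun g =>
      GL2.isDg_of_mem_center (Matrix.ProjGenLinGroup.mk_eq_one.mp (h g)))
  -- the last non-trivial term `M` of the derived series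
  obtain ⟨⟨n, hn⟩⟩ := hs
  have hex : ∃ m, derivedSeries (projectiveImage ρ) m = ⊥ := ⟨n, hn⟩
  obtain ⟨n₀, hn₀spec, hn₀min⟩ :
      ∃ n₀, derivedSeries (projectiveImage ρ) n₀ = ⊥ ∧
        ∀ m < n₀, derivedSeries (projectiveImage ρ) m ≠ ⊥ :=
    ⟨Nat.find hex, Nat.find_spec hex, fun m hm => Nat.find_min hex hm⟩
  have hn₀pos : n₀ ≠ 0 := by
    rintro rfl
    rw [derivedSeries_zero] at hn₀spec
    obtain ⟨g, hg⟩ := hnt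
    have : (⟨mk (ρ g), g, rfl⟩ : projectiveImage ρ) ∈
        (⊤ : Subgroup (projectiveImage ρ)) := mem_top _
    rw [hn₀spec, mem_bot] at this
    exact hg (congrArg Subtype.val this)
  set M := derivedSeries (projectiveImage ρ) (n₀ - 1) with hM
  have hMbot : M ≠ ⊥ := hn₀min (n₀ - 1) (by omega)
  haveI hMn : M.Normal := derivedSeries_normal _ _
  have hMab : ∀ a ∈ M, ∀ b ∈ M, a * b = b * a := by
    intro a ha b hb
    have h := commutator_mem_commutator ha hb
    rw [← derivedSeries_succ, show n₀ - 1 + 1 = n₀ by omega, hn₀spec, mem_bot,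
      commutatorElement_eq_one_iff_mul_comm] at h
    exact h
  -- Step 1: `M` has no involution
  have hM2 : ∀ y ∈ M, y * y = 1 → y = 1 := by
    intro y hyM hyy
    by_contra hy1
    apply hce
    let S : Set G := {g | (⟨mk (ρ g), g, rfl⟩ : projectiveImage ρ) ∈ M ∧ mk (ρ g) ≠ 1 ∧
      mk (ρ g) * mk (ρ g) = 1}
    have hSmem : ∀ g, g ∈ S ↔ ((⟨mk (ρ g), g, rfl⟩ : projectiveImage ρ) ∈ M ∧ mk (ρ g) ≠ 1 ∧
        mk (ρ g) * mk (ρ g) = 1) := fun g => Iff.rfl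
    refine CharTwoPGL2.hasCommonEigenvector_of_involutions ρ S ?_ ?_ ?_ ?_
    · obtain ⟨gy, hgy⟩ := y.2
      refine ⟨gy, (hSmem gy).2 ⟨?_, ?_, ?_⟩⟩
      · have : (⟨mk (ρ gy), gy, rfl⟩ : projectiveImage ρ) = y := Subtype.ext hgy
        rw [this]; exact hyM
      · intro h
        apply hy1
        exact Subtype.ext (by rw [OneMemClass.coe_one, ← hgy]; exact h)
      · have := congrArg Subtype.val hyy
        rw [Subgroup.coe_mul, OneMemClass.coe_one, ← hgy] at this
        exact this
    · intro s hs
      exact ⟨((hSmem s).1 hs).2.1, ((hSmem s).1 hs).2.2⟩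
    · intro s hs t ht
      exact congrArg Subtype.val (hMab _ ((hSmem s).1 hs).1 _ ((hSmem t).1 ht).1)
    · intro g s hs
      obtain ⟨hsM, hs1, hss⟩ := (hSmem s).1 hs
      refine (hSmem _).2 ⟨?_, ?_, ?_⟩
      · have hconj := hMn.conj_mem _ hsM (⟨mk (ρ g), g, rfl⟩ : projectiveImage ρ)⁻¹
        convert hconj using 1
        apply Subtype.ext
        simp only [map_mul, map_inv, Subgroup.coe_mul, Subgroup.coe_inv, inv_inv]
      · intro h
        apply hs1
        simp only [map_mul, map_inv] at h
        have h4 : mk (ρ s) = mk (ρ g) * ((mk (ρ g))⁻¹ * mk (ρ s) * mk (ρ g)) * (mk (ρ g))⁻¹ := by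
          group
        rw [h4, h, mul_one, mul_inv_cancel]
      · simp only [map_mul, map_inv]
        have h3 : (mk (ρ g))⁻¹ * mk (ρ s) * mk (ρ g) * ((mk (ρ g))⁻¹ * mk (ρ s) * mk (ρ g)) =
            (mk (ρ g))⁻¹ * (mk (ρ s) * mk (ρ s)) * mk (ρ g) := by group
        rw [h3, hss, mul_one, inv_mul_cancel]
  -- Step 2: every element of `M` has odd order
  have hModd : ∀ y ∈ M, Odd (orderOf y) := by
    intro y hyM
    rcases Nat.even_or_odd (orderOf y) with ⟨j, hj⟩ | hodd
    · exfalso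
      have hjpos : 0 < j := by
        rcases Nat.eq_zero_or_pos j with rfl | h
        · exact absurd hj (orderOf_pos y).ne'
        · exact h
      have hyj : y ^ j ≠ 1 := pow_ne_one_of_lt_orderOf hjpos.ne' (by omega)
      have hyjj : y ^ j * y ^ j = 1 := by rw [← pow_add, ← hj, pow_orderOf_eq_one]
      exact hyj (hM2 _ (M.pow_mem hyM j) hyjj)
    · exact hodd
  -- Step 3: a non-trivial `\bar y ∈ M`, diagonalised
  obtain ⟨y, hyM, hy1⟩ : ∃ y ∈ M, y ≠ (1 : projectiveImage ρ) :=
    (M.bot_or_exists_ne_one).resolve_left hMbot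
  obtain ⟨gy, hgy⟩ := y.2
  have hgy' : mk (ρ gy) = (y : PGL(2, k)) := hgy
  have hy₀ : ρ gy ∉ center (GL (Fin 2) k) := by
    intro h
    apply hy1
    apply Subtype.ext
    rw [OneMemClass.coe_one, ← hgy']
    exact Matrix.ProjGenLinGroup.mk_eq_one.mpr h
  have htk : ((orderOf y : ℕ) : k) ≠ 0 := by
    obtain ⟨m, hm⟩ := hModd y hyM
    rw [hm, Nat.cast_add, Nat.cast_mul, Nat.cast_two, CharTwo.two_eq_zero, zero_mul, zero_add,
      Nat.cast_one]
    exact one_ne_zero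
  have hyt : mk (ρ gy) ^ orderOf y = 1 := by
    rw [hgy', ← Subgroup.coe_pow, pow_orderOf_eq_one, OneMemClass.coe_one]
  obtain ⟨Q, d, hd, hQ⟩ :=
    CharTwoPGL2.exists_conj_eq_diagonal_of_mk_pow_eq_one (ρ gy) htk hyt hy₀
  set ρ' := conjGL Q⁻¹ ρ with hρ'
  have hyd : ((ρ' gy : GL (Fin 2) k) : Matrix (Fin 2) (Fin 2) k) = diagonal d := by
    rw [hρ', conjGL_apply, inv_inv]
    exact hQ
  haveI := finite_range_of_finite ρ'
  haveI : Finite (projectiveImage ρ') := finite_projectiveImage_of_finite_range ρ'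
  -- transport `M`
  set e := projectiveImageConjEquiv Q⁻¹ ρ with he
  set M' : Subgroup (projectiveImage ρ') :=
    M.map (e : projectiveImage ρ →* projectiveImage ρ') with hM'
  haveI hM'n : M'.Normal := Subgroup.Normal.map hMn _ e.surjective
  have hM'ab : ∀ a ∈ M', ∀ b ∈ M', a * b = b * a := by
    rintro _ ⟨a, ha, rfl⟩ _ ⟨b, hb, rfl⟩
    rw [← map_mul, ← map_mul, hMab a ha b hb]
  have hM'2 : ∀ a ∈ M', a * a = 1 → a = 1 := by
    rintro _ ⟨a, ha, rfl⟩ haa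
    have haa' : a * a = 1 := by
      apply e.injective
      rw [map_mul, map_one]
      simpa using haa
    show (e : projectiveImage ρ →* projectiveImage ρ') a = 1
    rw [hM2 a ha haa', map_one]
  have hyM' : (⟨mk (ρ' gy), gy, rfl⟩ : projectiveImage ρ') ∈ M' := by
    refine ⟨y, hyM, Subtype.ext ?_⟩
    show ((e y : projectiveImage ρ') : PGL(2, k)) = mk (ρ' gy)
    rw [he, coe_projectiveImageConjEquiv, hρ', mk_conjGL, MulAut.conj_apply, hgy']
  -- Step 4: elements of `M'` have diagonal lifts
  have hshape : ∀ g, (⟨mk (ρ' g), g, rfl⟩ : projectiveImage ρ') ∈ M' →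
      GL2.IsDg ((ρ' g : GL (Fin 2) k) : Matrix (Fin 2) (Fin 2) k) ∨
        GL2.IsAd ((ρ' g : GL (Fin 2) k) : Matrix (Fin 2) (Fin 2) k) := by
    intro g hg
    have h' := congrArg Subtype.val (hM'ab _ hg _ hyM')
    change mk (ρ' g) * mk (ρ' gy) = mk (ρ' gy) * mk (ρ' g) at h'
    rw [← map_mul Matrix.ProjGenLinGroup.mk, ← map_mul Matrix.ProjGenLinGroup.mk,
      GL2.mk_eq_mk_iff_smul, Matrix.GeneralLinearGroup.coe_mul,
      Matrix.GeneralLinearGroup.coe_mul, hyd] at h'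
    obtain ⟨u, hu⟩ := h'
    have key : ((ρ' g : GL (Fin 2) k) : Matrix (Fin 2) (Fin 2) k) * diagonal d =
        diagonal ((u : k)⁻¹ • d) * ((ρ' g : GL (Fin 2) k) : Matrix (Fin 2) (Fin 2) k) := by
      rw [diagonal_smul, smul_mul_assoc, ← hu, smul_smul, inv_mul_cancel₀ u.ne_zero,
        one_smul]
    exact GL2.isDg_or_isAd_of_mul_diagonal (GL2.det_ne_zero _) hd key
  have hdiag : ∀ g, (⟨mk (ρ' g), g, rfl⟩ : projectiveImage ρ') ∈ M' →
      GL2.IsDg ((ρ' g : GL (Fin 2) k) : Matrix (Fin 2) (Fin 2) k) := by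
    intro g hg
    rcases hshape g hg with h | h
    · exact h
    · -- an antidiagonal lift gives an involution of `M'`
      exfalso
      have hinv : mk (ρ' g) * mk (ρ' g) = 1 := GL2.mk_mul_mk_self_eq_one h.mul_self
      have h1 : (⟨mk (ρ' g), g, rfl⟩ : projectiveImage ρ') = 1 :=
        hM'2 _ hg (Subtype.ext hinv)
      have h2 : ρ' g ∈ center (GL (Fin 2) k) :=
        Matrix.ProjGenLinGroup.mk_eq_one.mp (congrArg Subtype.val h1)
      exact h.not_isDg (GL2.det_ne_zero _) (GL2.isDg_of_mem_center h2)
  -- Step 5: `ρ'` is monomial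
  have hmono : ∀ g, GL2.IsDg ((ρ' g : GL (Fin 2) k) : Matrix (Fin 2) (Fin 2) k) ∨
      GL2.IsAd ((ρ' g : GL (Fin 2) k) : Matrix (Fin 2) (Fin 2) k) := by
    intro g
    -- `\bar ρ'(g) \bar y \bar ρ'(g)⁻¹ ∈ M'` is the class of `ρ'(g gy g⁻¹)`, which is diagonal
    have hmem : (⟨mk (ρ' (g * gy * g⁻¹)), g * gy * g⁻¹, rfl⟩ : projectiveImage ρ') ∈ M' := by
      have hconj := hM'n.conj_mem _ hyM' (⟨mk (ρ' g), g, rfl⟩ : projectiveImage ρ')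
      convert hconj using 1
      apply Subtype.ext
      simp only [map_mul, map_inv, Subgroup.coe_mul, Subgroup.coe_inv]
    have hw := hdiag _ hmem
    -- `ρ'(g) y = u • (w ρ'(g))` with `w = ρ'(g gy g⁻¹)` diagonal
    have hrel : mk (ρ' g * ρ' gy) = mk (ρ' (g * gy * g⁻¹) * ρ' g) := by
      congr 1
      rw [map_mul, map_mul, map_inv, inv_mul_cancel_right]
    rw [GL2.mk_eq_mk_iff_smul, Matrix.GeneralLinearGroup.coe_mul,
      Matrix.GeneralLinearGroup.coe_mul, hyd] at hrel
    obtain ⟨u, hu⟩ := hrel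
    set w : Matrix (Fin 2) (Fin 2) k :=
      ((ρ' (g * gy * g⁻¹) : GL (Fin 2) k) : Matrix (Fin 2) (Fin 2) k) with hwdef
    have hdg : GL2.IsDg ((u : k)⁻¹ • w) := hw.smul _
    have key : ((ρ' g : GL (Fin 2) k) : Matrix (Fin 2) (Fin 2) k) * diagonal d =
        diagonal ![((u : k)⁻¹ • w) 0 0, ((u : k)⁻¹ • w) 1 1] *
          ((ρ' g : GL (Fin 2) k) : Matrix (Fin 2) (Fin 2) k) := by
      rw [← hdg.eq_diagonal, smul_mul_assoc, ← hu, smul_smul, inv_mul_cancel₀ u.ne_zero,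
        one_smul]
    exact GL2.isDg_or_isAd_of_mul_diagonal (GL2.det_ne_zero _) hd key
  have hDex : ∃ g, GL2.IsDg ((ρ' g : GL (Fin 2) k) : Matrix (Fin 2) (Fin 2) k) ∧
      ((ρ' g : GL (Fin 2) k) : Matrix (Fin 2) (Fin 2) k) 0 0 ≠
        ((ρ' g : GL (Fin 2) k) : Matrix (Fin 2) (Fin 2) k) 1 1 :=
    ⟨gy, by rw [hyd]; exact GL2.isDg_diagonal d, by rw [hyd]; simpa using hd⟩
  have hAex : ∃ g, GL2.IsAd ((ρ' g : GL (Fin 2) k) : Matrix (Fin 2) (Fin 2) k) := by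
    by_contra hA
    push Not at hA
    exact hce (HasCommonEigenvector.of_conjGL (P := Q⁻¹)
      (hasCommonEigenvector_of_forall_isDg fun g => (hmono g).resolve_right (hA g)))
  exact isDihedralType_of_conjGL (isDihedralType_of_monomial ρ' hmono hDex hAex)

end Core

/-! ### Main results -/

section Main

variable {G : Type*} [Group G] {k : Type*} [Field k] [IsAlgClosed k] [CharP k 2]

/-- **Khare–Wintenberger (I), Lemma 6.1: solvable irreducible image in characteristic `2` is of
dihedral type.**  Let `k` be an algebraically closed field of characteristic `2` (e.g. `𝔽̄₂`)
and `ρ : G →* GL₂(k)` a homomorphism with finite solvable image whose standard representation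
on `k²` is irreducible.  Then the projective image `\bar ρ(G) ≤ PGL₂(k)` is dihedral:
`IsDihedralType ρ` (`\bar ρ(G) ≃* DihedralGroup m` for some `m ≥ 2`).  Printed for a finite
solvable `G ≤ GL₂(𝔽̄₂)` acting irreducibly on `𝔽̄₂²` ("Then the projective image of `G` is
dihedral"); `G ≤ GL₂` is the case `ρ = G.subtype`
(`isDihedralType_subtype_of_isSolvable_of_charTwo`).  The tetrahedral and octahedral types of
the characteristic-`0` statement `isDihedralType_or_isTetrahedralType_or_isOctahedralType`
do not occur. [cite: KhareWintenberger2009, §6, Lemma 6.1] -/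
theorem isDihedralType_of_isIrreducible_of_isSolvable_of_charTwo (ρ : G →* GL (Fin 2) k)
    [Finite ρ.range] (hirr : (toStdRepresentation ρ).IsIrreducible) (hs : IsSolvable ρ.range) :
    IsDihedralType ρ := by
  set ι : ρ.range →* GL (Fin 2) k := ρ.range.subtype with hι
  have hPI : projectiveImage ι = projectiveImage ρ := projectiveImage_range_subtype ρ
  have hce : ¬ HasCommonEigenvector ι := by
    rintro ⟨v, hv0, key⟩
    exact not_hasCommonEigenvector_of_isIrreducible ρ hirr
      ⟨v, hv0, fun g => key ⟨ρ g, g, rfl⟩⟩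
  have hsol : IsSolvable (projectiveImage ι) := by
    rw [hPI]
    haveI := hs
    exact isSolvable_projectiveImage_of_range ρ
  obtain ⟨m, hm, ⟨e⟩⟩ := isDihedralType_of_not_hasCommonEigenvector_of_charTwo ι hce hsol
  exact ⟨m, hm, ⟨(MulEquiv.subgroupCongr hPI.symm).trans e⟩⟩

/-- **Khare–Wintenberger (I), Lemma 6.1, as printed.**  A finite solvable subgroup `H` of
`GL₂(k)`, `k` algebraically closed of characteristic `2` (e.g. `k = 𝔽̄₂`), acting irreducibly
on `k²`, has dihedral projective image: `IsDihedralType H.subtype`, i.e. the image of `H` in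
`PGL₂(k)` is `≃* DihedralGroup m` for some `m ≥ 2`. [cite: KhareWintenberger2009, §6, Lemma 6.1] -/
theorem isDihedralType_subtype_of_isSolvable_of_charTwo (H : Subgroup (GL (Fin 2) k))
    [Finite H] (hs : IsSolvable H) (hirr : (toStdRepresentation H.subtype).IsIrreducible) :
    IsDihedralType H.subtype := by
  haveI : Finite H.subtype.range := by rw [Subgroup.range_subtype]; infer_instance
  have hs' : IsSolvable H.subtype.range := by rw [Subgroup.range_subtype]; exact hs
  exact isDihedralType_of_isIrreducible_of_isSolvable_of_charTwo H.subtype hirr hs'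

end Main

end Literature.NumberTheory.GaloisRepresentations
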